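import Summits.FinalStateConjecture.FinalStateConjecture.Theorems.BartnikGapSettlingBondiBartnikRigidityKillingDomainCausal
import Literature.Geometry.Lorentzian.KerrDataEmbedding
import Literature.Geometry.Lorentzian.KerrDataProofs
import Literature.Geometry.Lorentzian.KerrSliceFacts
import Literature.Geometry.Lorentzian.CauchyDevelopmentComap
import Literature.Geometry.Lorentzian.DataEmbeddingNormalSmooth
import Literature.Geometry.Lorentzian.CauchyProblemLocalUniqueness
import Literature.Geometry.Lorentzian.CauchyProblemMGHDExistence
import Literature.Geometry.Lorentzian.OpensCausality
import Literature.Geometry.Lorentzian.KerrSchildChartCovariance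
import Literature.Geometry.Lorentzian.KerrHyperboloidalLeaves
import Literature.Geometry.Lorentzian.HypersurfaceRestriction
import Literature.Geometry.Manifold.EmbeddingRangeDiffeomorph
import Literature.Geometry.Manifold.InverseFunctionTheorem
import HarnessLib

/-!
# F1 DEFS — vocabulary and corrected statement of the slab-jet Cauchy rigidity F1' — line
# `direct-method-on-the-cone`, crux `BondiBartnikRigidity` (stmt-FinalStateConjecture-10807); worker F1,
# wave 2 of lead a2 (module 1 of the landing of the sorry-free conditional proof of F1')

See `stub_slabCauchyRigidity.report.md` next to this file.  Summary:

* the REGISTERED `K2Route.SlabCauchyRigidity` is mis-stated twice: (T) no hypothesis pins the time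
  orientation of the collar chart `Φ₀` (the time-reversed exact Kerr development refutes the
  conclusion `Ψ = Φ₀` on the slab + image in `J⁺(C)`), and (R) for `a ≠ 0` the region
  `slabDiamond = {0 < t*, t* + r < 3M}` is NOT inside the Kerr domain of dependence of the slab
  (`{v = t* + r = const}` is TIMELIKE off the axis: `g⁻¹(dv, dv) = a² sin²θ / Σ > 0`), so the
  conclusion asserts Kerrness of a region the hypotheses do not determine;
* the corrected statement `SlabCauchyRigidity'` below adds the orientation clause (H8) and replaces
  the diamond by `slabDiamond' = {0 < t*, 3 t* + 2 r < 6 M}` (inside `D⁺_Kerr(slab°)` for every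
  `|a| < M` since `|ṙ| < √2 |ṫ*|` along causal curves of the star chart `{r > M}`; it still contains
  the K1 shell box `{0 < t* < M/4, 2M < r < 5M/2}`);
* the route: `SlabCauchyRigidity'` ⟸ (A) `SlabSubdatum` (steps (a)+(b): the exact `1`-jet makes the
  slab a Kerr sub-datum of `D`) ∧ (C) `KerrSlabLensCauchy` (step (c): the open slab is a Cauchy
  hypersurface of an explicit lens of the Kerr star chart) ∧ (D) `SubdataDevelopmentsEmbedLit`
  (step (d): localisation, Literature-vocabulary body of route item 10053 of `SwallowTheDatum`,
  conditionally closed in the tree) ∧ (E) `SubdevelopmentFuturePlacement` (step (e)).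
-/

noncomputable section

-- D-0017: single-problem summit, `Summit.<S>.<S>.…` by design (cf. lakefile `weak.linter.dupNamespace`).
set_option linter.dupNamespace false
set_option maxSynthPendingDepth 3

open Set Filter Function Topology TopologicalSpace Bundle
open Literature.Geometry.Lorentzian
open scoped Manifold ContDiff Topology ENNReal

namespace Summit.FinalStateConjecture.FinalStateConjecture.Theorems.BondiBartnikRigidity.DirectMethod

namespace F1Route

/-! (The Kerr chart facts `Kerr.Facts` hold in the tree — `Kerr.isConnected_region_holds`,
`Kerr.contMDiff_bilin_holds`, `Kerr.contMDiff_timeVector_holds`; cf. `SwallowTheDatum.kerrFacts` — and are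
supplied inline by `haveI` where a `[Kerr.Facts]` statement is used.) -/

/-! ### Kerr-side sets (unboosted star chart `Kerr.region a M`) -/

/-- The OPEN Kerr-side slab `slab° = {t* = 0, r < 3M}` (within `{r > M}`). -/
def slabKo (M a : ℝ) : Set (Kerr.region a M) := {y | y.1 0 = 0 ∧ Kerr.radius a y.1 < 3 * M}

/-- The Kerr-side SLAB LENS `V_K = {6M − 2r − 3t* > 0} ∩ {6M − 2r + 3t* > 0} ∩ {2t* + r − M > 0}`:
an open neighbourhood of `slab°` in which (route statement (C)) `slab°` is a Cauchy hypersurface;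
its three boundary functions are monotone along future causal curves of the star chart because
`|ṙ| < √2 |ṫ*|` there (`|∇r|²_δ = (r² + a²)/Σ < 2` for `|a| < M < r`, and `|ẋ|_δ ≤ ẋ⁰` for
`g`-causal `ẋ` since `H ≥ 0`). -/
def lensK (M a : ℝ) : Set (Kerr.region a M) :=
  {y | 0 < 6 * M - 2 * Kerr.radius a y.1 - 3 * y.1 0 ∧ 0 < 6 * M - 2 * Kerr.radius a y.1 + 3 * y.1 0 ∧
    0 < 2 * y.1 0 + (Kerr.radius a y.1 - M)}

/-- The future part `{t* > 0}` of the lens: the Kerr-side corrected diamond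
`Δ'_K = {0 < t*, 3t* + 2r < 6M}`. -/
def diamondK (M a : ℝ) : Set (Kerr.region a M) :=
  {y | 0 < y.1 0 ∧ 0 < 6 * M - 2 * Kerr.radius a y.1 - 3 * y.1 0}

/-- The open slab lies in its lens. [folklore] -/
theorem slabKo_subset_lensK {M a : ℝ} : slabKo M a ⊆ lensK M a := by
  intro y hy
  obtain ⟨h0, hr⟩ := hy
  have hM : M < Kerr.radius a y.1 := (le_max_left M 0).trans_lt y.2
  refine ⟨by rw [h0]; linarith, by rw [h0]; linarith, by rw [h0]; linarith⟩

/-- The Kerr-side corrected diamond lies in the lens. [folklore] -/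
theorem diamondK_subset_lensK {M a : ℝ} : diamondK M a ⊆ lensK M a := by
  intro y hy
  obtain ⟨h0, h1⟩ := hy
  have hM : M < Kerr.radius a y.1 := (le_max_left M 0).trans_lt y.2
  exact ⟨h1, by linarith, by linarith⟩

/-- The lens of the open slab is open in the star chart. [folklore] -/
theorem isOpen_lensK (M a : ℝ) : IsOpen (lensK M a) := by
  have hr : Continuous fun y : Kerr.region a M => Kerr.radius a y.1 :=
    (Kerr.continuous_radius a).comp continuous_subtype_val
  have h0 : Continuous fun x : E4 => x 0 := PiLp.continuous_apply 2 _ 0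
  have ht : Continuous fun y : Kerr.region a M => y.1 0 := h0.comp continuous_subtype_val
  simp only [lensK, Set.setOf_and]
  refine (isOpen_lt continuous_const ?_).inter ((isOpen_lt continuous_const ?_).inter
    (isOpen_lt continuous_const ?_)) <;> fun_prop

/-- Pull-back of a Kerr-side set to the domain of a background along the rest-frame map
`x ↦ Λ⁻¹(x − c)` (verbatim `pullK` of the route file `…StationaryKerrCollarRoute.lean`, renamed
here only because that module is imported by the final form of this file). -/
def pullK' (mo : lorentzGroup × E4) (M a : ℝ) (B : ModelBackground) (S : Set (Kerr.region a M)) :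
    Set B.domain :=
  {x | ∃ h : poincareInv mo.1 mo.2 x.1 ∈ Kerr.region a M, (⟨poincareInv mo.1 mo.2 x.1, h⟩ : Kerr.region a M) ∈ S}

/-! ### Background-side corrected regions -/

/-- The CORRECTED future inner diamond `Δ' = {0 < t*, 3t* + 2r < 6M}` of the thick slab: inside
the Kerr future domain of dependence of the open slab for every `|a| < M` (the registered
`slabDiamond = {0 < t*, t* + r < 3M}` is not, for `a ≠ 0`). -/
def slabDiamond' (B : ModelBackground) (M : ℝ) : Set B.domain :=
  {x | 0 < B.time x.1 ∧ 3 * B.time x.1 + 2 * B.radius x.1 < 6 * M}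

/-- `Δ'` together with the open slab: `{0 ≤ t*, 3t* + 2r < 6M}`. -/
def slabDiamondWithSlab' (B : ModelBackground) (M : ℝ) : Set B.domain :=
  {x | 0 ≤ B.time x.1 ∧ 3 * B.time x.1 + 2 * B.radius x.1 < 6 * M}

/-- The background-side corrected diamond is the pull-back of the Kerr-side one. [folklore] -/
theorem slabDiamond'_eq_pullK' {mo : lorentzGroup × E4} {M a : ℝ} {B : ModelBackground}
    (hB : B = starBackground mo.1 mo.2 M a (fun x => Kerr.radius a (poincareInv mo.1 mo.2 x))) :
    slabDiamond' B M = pullK' mo M a B (diamondK M a) := by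
  subst hB
  ext x
  constructor
  · intro hx
    obtain ⟨h0, h1⟩ : 0 < poincareInv mo.1 mo.2 x.1 0 ∧
        3 * (poincareInv mo.1 mo.2 x.1 0) + 2 * Kerr.radius a (poincareInv mo.1 mo.2 x.1) < 6 * M := hx
    exact ⟨x.2, h0, by change 0 < 6 * M - 2 * Kerr.radius a (poincareInv mo.1 mo.2 x.1) - 3 * _; linarith⟩
  · rintro ⟨hmem, hd⟩
    obtain ⟨h0, h1⟩ : 0 < poincareInv mo.1 mo.2 x.1 0 ∧
        0 < 6 * M - 2 * Kerr.radius a (poincareInv mo.1 mo.2 x.1) - 3 * (poincareInv mo.1 mo.2 x.1 0) := hd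
    exact ⟨h0, by change 3 * (poincareInv mo.1 mo.2 x.1 0) + 2 * Kerr.radius a _ < 6 * M; linarith⟩


/-! ### The open slab as an abstract `3`-manifold and its Kerr-side embedding -/

/-- The OPEN THICK SLAB `N = {y ∈ Kerr.slice a M | r_a(0, y) < 3M}` = `{M < r < 3M}` as an open
sub-manifold of the Kerr–Schild slice `Kerr.slice a M` (itself an open subset of `E3`). -/
def slabW (M a : ℝ) : Opens (Kerr.slice a M) :=
  ⟨{y | Kerr.radius a (E4.ofTimeSpace 0 (y : E3)) < 3 * M},
    isOpen_lt (((Kerr.continuous_radius a).comp (E4.continuous_ofTimeSpace 0)).comp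
      continuous_subtype_val) continuous_const⟩

/-- The Kerr-side embedding `y ↦ (0, y)` of the open slab into the star chart `Kerr.region a M`
(restriction of `Kerr.sliceEmbed`). -/
def ψN (M a : ℝ) : slabW M a → Kerr.region a M := Kerr.sliceEmbed a M ∘ Subtype.val

/-- The Kerr future unit normal along the open slab (restriction of `Kerr.sliceNormal`). -/
def νN (M a : ℝ) : NormalField 𝓘(ℝ, E4) (ψN M a) := fun y => Kerr.sliceNormal M a M y.1

/-- The Kerr-side slab embedding in coordinates: `y ↦ (0, y)`. [folklore] -/
theorem coe_ψN (M a : ℝ) (y : slabW M a) : (ψN M a y : E4) = E4.ofTimeSpace 0 (y : E3) := rfl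

/-- The Kerr-side slab embedding lands in the open slab. [folklore] -/
theorem ψN_mem_slabKo (M a : ℝ) (y : slabW M a) : ψN M a y ∈ slabKo M a :=
  ⟨rfl, y.2⟩

/-! ### The four route statements -/

section Statements

/-- **(A) `SlabSubdatum`** — steps (a)+(b) of the paper proof: the exact `1`-jet of a
future-oriented collar chart on the thick slab makes the open slab a KERR SUB-DATUM of `D`: there
is a smooth open embedding `Φ_N : N → X` with injective differentials such that
`ι ∘ Φ_N = Φ₀ ∘ (y ↦ Λ(0,y) + c)` and, pointwise, `Φ_N^* h = ψ_N^* g_{M,a}` and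
`Φ_N^* k = K_ν(ψ_N)` (the Kerr slab data).  (a) is the smooth factorisation through the embedded
hypersurface `ι(X)` (`Literature.Geometry.Manifold.exists_contMDiff_comp_eq_of_range_subset`);
(b): order `0` of the jet gives `h`, order `1` gives the Christoffel symbols and hence `K` at slab
points, the future unit normal being pinned by (H8) (`TimeOrientation.eq_of_isFutureUnitNormal`).
MISSING in the tree (true on paper).  Route-posited statement of the line; nothing is asserted. [conjecture] [folklore] -/
def SlabSubdatum : Prop :=
  ∀ [Kerr.Facts] [Kerr.SliceFacts] (k' : ℕ), 1 ≤ k' →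
    ∀ (X : Type) [TopologicalSpace X] [ChartedSpace E3 X] [IsManifold (𝓡 3) ∞ X]
      [T2Space X] [SecondCountableTopology X] [ConnectedSpace X]
      (D : InitialDataSet (𝓡 3) X) (𝒱 : VacuumCauchyDevelopment D)
      (M a : ℝ) (mo : lorentzGroup × E4) (B : ModelBackground) (Φ₀ : B.domain → 𝒱.carrier),
    0 < M → |a| < M →
    B = starBackground mo.1 mo.2 M a (fun x => Kerr.radius a (poincareInv mo.1 mo.2 x)) →
    (ContMDiffOn 𝓘(ℝ, E4) (𝓡 4) ∞ Φ₀
        {x | -1 < B.time x.1 ∧ B.time x.1 < 1 ∧ B.radius x.1 < 3 * M + 1} ∧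
      IsOpenEmbedding ({x | -1 < B.time x.1 ∧ B.time x.1 < 1 ∧
        B.radius x.1 < 3 * M + 1}.restrict Φ₀)) →
    𝒱.toSpacetime.truncDeviationCk B Φ₀ k' (3 * M) 0 ≤ 0 →
    Φ₀ '' B.truncTimeSlab (3 * M) 0 ⊆ range 𝒱.embed →
    (∀ x ∈ B.truncTimeSlab (3 * M) 0, 𝒱.timeOrientation.IsFutureDirected
      (mfderiv 𝓘(ℝ, E4) (𝓡 4) Φ₀ x
        ((mo.1 : E4 ≃L[ℝ] E4) (Kerr.timeVector M a (poincareInv mo.1 mo.2 x.1))))) →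
    ∃ ΦN : slabW M a → X, ContMDiff (𝓡 3) (𝓡 3) ((((⊤ : ℕ∞) : WithTop ℕ∞)) + 1) ΦN ∧
      (∀ u, Injective (mfderiv (𝓡 3) (𝓡 3) ΦN u)) ∧ IsOpenEmbedding ΦN ∧
      (∀ y : slabW M a, ∃ hx : ((mo.1 : E4 ≃L[ℝ] E4) (E4.ofTimeSpace 0 (y : E3)) + mo.2) ∈ B.domain,
          𝒱.embed (ΦN y) = Φ₀ ⟨_, hx⟩) ∧
      (∀ (y : slabW M a) (v w : E3),
          D.h.inner (ΦN y) (mfderiv (𝓡 3) (𝓡 3) ΦN y v) (mfderiv (𝓡 3) (𝓡 3) ΦN y w) =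
            Kerr.bilin M a (ψN M a y : E4) (mfderiv 𝓘(ℝ, E3) 𝓘(ℝ, E4) (ψN M a) y v)
              (mfderiv 𝓘(ℝ, E3) 𝓘(ℝ, E4) (ψN M a) y w)) ∧
      (∀ [(Kerr.smoothMetric M a M).HasLeviCivita] (y : slabW M a) (v w : E3),
          D.k (ΦN y) (mfderiv (𝓡 3) (𝓡 3) ΦN y v) (mfderiv (𝓡 3) (𝓡 3) ΦN y w) =
            (Kerr.smoothMetric M a M).secondFundamentalForm 𝓘(ℝ, E3) (ψN M a) (νN M a) y v w)

/-- **(C) `KerrSlabLensCauchy`** — step (c): in the Kerr star chart `{r > M}` (`0 < M`,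
`|a| < M`) the open slab `slab° = {t* = 0, r < 3M}` and the lens `V_K` (`lensK`) are connected,
`slab°` is a CAUCHY HYPERSURFACE of the open sub-spacetime `V_K`, and the future part
`{t* > 0} ∩ V_K` (`diamondK`) lies in the chronological future of `slab°` inside `V_K`.  Proof
on paper (order theory of three clocks, template `SwallowTheDatum….stub_collarCauchy`): along
future timelike curves of the chart `t*` increases, `|ṙ| < √2 ṫ*`, so `6M − 2r − 3t*` decreases
and `6M − 2r + 3t*`, `2t* + r − M` increase; in `{r < r₊}` `r` increases to the past; endpoints
exist by the Minkowski comparison `η(v,v) ≤ g(v,v)` (`MinkowskiCauchy`).  MISSING (closable;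
Kerr causal geometry shared with K2c `stub_kerrLateBoxPlacement`).  Route-posited statement of the line; nothing is asserted. [conjecture] [folklore] -/
def KerrSlabLensCauchy : Prop :=
  ∀ [Kerr.Facts] (M a : ℝ) (hM : 0 < M), |a| < M →
    IsConnected (slabW M a : Set (Kerr.slice a M)) ∧ IsConnected (lensK M a) ∧
    ((Kerr.spacetime M a M hM.le).metric.restrict PseudoRiemannianMetric.contMDiff_restrict_holds
        ⟨lensK M a, isOpen_lensK M a⟩).IsCauchyHypersurface
      ((Kerr.spacetime M a M hM.le).timeOrientation.restrict
        PseudoRiemannianMetric.contMDiff_restrict_holds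
        (Kerr.spacetime M a M hM.le).timeOrientation.contMDiff_restrict_holds
        ⟨lensK M a, isOpen_lensK M a⟩)
      (Subtype.val ⁻¹' slabKo M a) ∧
    (Subtype.val ⁻¹' diamondK M a : Set (⟨lensK M a, isOpen_lensK M a⟩ : Opens (Kerr.region a M))) ⊆
      ((Kerr.spacetime M a M hM.le).metric.restrict PseudoRiemannianMetric.contMDiff_restrict_holds
        ⟨lensK M a, isOpen_lensK M a⟩).chronologicalFuture
      ((Kerr.spacetime M a M hM.le).timeOrientation.restrict
        PseudoRiemannianMetric.contMDiff_restrict_holds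
        (Kerr.spacetime M a M hM.le).timeOrientation.contMDiff_restrict_holds
        ⟨lensK M a, isOpen_lensK M a⟩)
      (Subtype.val ⁻¹' slabKo M a)

/-- **(D) `SubdataDevelopmentsEmbedLit`** — step (d), THE LOCALISATION PRINCIPLE (Literature
vocabulary; verbatim the body of route item `SubdataDevelopmentsEmbed`, stmt-FinalStateConjecture-10053,
of route `SwallowTheDatum`): every vacuum Cauchy development of the sub-datum `Φ^* D` along a
smooth open embedding `Φ : N → X` with injective differentials embeds, over `Φ`, into every
MAXIMAL vacuum Cauchy development of `D`.  In the tree it is CONDITIONALLY CLOSED three ways: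
`subdataDevelopmentsEmbed_of_choquetBruhatGeroch : choquetBruhat_geroch_exists_mghd_cauchy → …`
(`…SubdataDevelopmentsEmbedLocalisationHolds.lean`),
`subdataDevelopmentsEmbed_of_locallyUnique_of_sbierski : hawkingEllis_locallyUnique_vacuumDevelopment →
sbierski_commonDevelopment_lt_of_hasCorrespondingBoundaryPoints → …` (`…TwoFacts.lean`),
`subdataDevelopmentsEmbed_of_locallyUnique_of_ncb` (`…Final.lean`) — all stated over the Theses
name, hence re-stated here. (ref: HawkingEllis1973CUP, §7.6) (ref: ChoquetBruhatGeroch1969CMP, Thm. 3)  Route-posited statement of the line; nothing is asserted. [conjecture] [folklore] -/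
def SubdataDevelopmentsEmbedLit : Prop :=
  ∀ (X : Type) [TopologicalSpace X] [ChartedSpace E3 X] [IsManifold (𝓡 3) ∞ X] [T2Space X]
    [SecondCountableTopology X] [ConnectedSpace X] (D : InitialDataSet (𝓡 3) X)
    (𝒟 : VacuumCauchyDevelopment D), 𝒟.IsMaximal →
    ∀ (N : Type) [TopologicalSpace N] [ChartedSpace E3 N] [IsManifold (𝓡 3) ∞ N] [ConnectedSpace N]
      (Φ : N → X) (hΦ : ContMDiff (𝓡 3) (𝓡 3) ((((⊤ : ℕ∞) : WithTop ℕ∞)) + 1) Φ)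
      (hΦ' : ∀ u, Injective (mfderiv (𝓡 3) (𝓡 3) Φ u)), IsOpenEmbedding Φ →
      ∀ 𝒟' : VacuumCauchyDevelopment (D.comap Φ hΦ hΦ'),
      ∃ χ : 𝒟'.carrier → 𝒟.carrier, ContMDiff (𝓡 4) (𝓡 4) ∞ χ ∧ IsOpenEmbedding χ ∧
        𝒟'.metric.IsIsometricImmersion 𝒟.metric.toPseudoRiemannianMetric χ ∧
        𝒟'.timeOrientation.PreservesTimeOrientation χ 𝒟.timeOrientation ∧
        χ ∘ 𝒟'.embed = 𝒟.embed ∘ Φ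

/-- **(E) `SubdevelopmentFuturePlacement`** — step (e) in general form: if a Cauchy development
`𝒦` (of any datum on any `N`) embeds isometrically, openly and future-preservingly into a
spacetime `𝒮` by `χ`, then `χ` maps the chronological future of the Cauchy hypersurface of `𝒦`
into the FAITHFUL future domain of dependence `D⁺_𝒮(χ(ι_𝒦 N))` (`futureDomain`): a past-endless
causal curve of `𝒮` through `χ y` has a portion in the open set `χ(𝒦)` that is past-endless in
`χ(𝒦) ≅ 𝒦`, and in `𝒦` every past-endless causal curve through a point of `I⁺(ι N)` meets
`ι N` (O'Neill 1983, Lemma 14.29, one-sided form).  MISSING (pure causal theory; closable from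
`OpensCausality`, `CauchyHypersurfaceTransfer`, `CauchyHypersurfaceCausalProofs`).  Route-posited statement of the line; nothing is asserted. [conjecture] [folklore] -/
def SubdevelopmentFuturePlacement : Prop :=
  ∀ (N : Type) [TopologicalSpace N] [ChartedSpace E3 N] [IsManifold (𝓡 3) ∞ N] [ConnectedSpace N]
    (D₁ : InitialDataSet (𝓡 3) N) (𝒦 : CauchyDevelopment D₁) (𝒮 : Spacetime.{0} 4)
    (χ : 𝒦.carrier → 𝒮.carrier), ContMDiff (𝓡 4) (𝓡 4) ∞ χ → IsOpenEmbedding χ →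
    𝒦.metric.IsIsometricImmersion 𝒮.metric.toPseudoRiemannianMetric χ →
    𝒦.timeOrientation.PreservesTimeOrientation χ 𝒮.timeOrientation →
    χ '' (𝒦.metric.chronologicalFuture 𝒦.timeOrientation (range 𝒦.embed)) ⊆
      futureDomain 𝒮 (χ '' range 𝒦.embed)

end Statements

/-! ### The corrected F1 -/

variable {X : Type} [TopologicalSpace X] [ChartedSpace E3 X] [IsManifold (𝓡 3) ∞ X]
  [ConnectedSpace X] {D : InitialDataSet (𝓡 3) X}

/-- **F1' `SlabCauchyRigidity'`** — the CORRECTED slab-jet Cauchy rigidity: the registered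
`K2Route.SlabCauchyRigidity` with (i) the additional hypothesis (H8) that the collar charts are
future-oriented on their slabs (`dΦᵢ(Λᵢ V)` future-directed, `V = −g♯dt*` the Kerr-star time
orientation), and (ii) the diamond `slabDiamond` replaced by `slabDiamond' = {0 < t*, 3t* + 2r < 6M}`
(inside the Kerr future domain of dependence of the open slab for every `|a| < M`).  Route-posited statement of the line; nothing is asserted. [conjecture] [folklore] -/
def SlabCauchyRigidity' : Prop :=
  ∀ (k' : ℕ), 1 ≤ k' →
    ∀ (X : Type) [TopologicalSpace X] [ChartedSpace E3 X] [IsManifold (𝓡 3) ∞ X]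
      [T2Space X] [SecondCountableTopology X] [ConnectedSpace X]
      (D : InitialDataSet (𝓡 3) X) (𝒱 : VacuumCauchyDevelopment D)
      (M a : Fin 1 → ℝ) (p : 𝒱.carrier) (mo : Fin 1 → lorentzGroup × E4)
      (B : Fin 1 → ModelBackground) (Φ : ∀ i, (B i).domain → 𝒱.carrier),
    𝒱.IsMaximal → (∀ i, 0 < M i ∧ |a i| < M i) →
    (∃ i, p ∈ Φ i '' (B i).truncTimeSlab (3 * M i) 0) →
    (∀ i, B i = starBackground (mo i).1 (mo i).2 (M i) (a i)
      (fun x => Kerr.radius (a i) (poincareInv (mo i).1 (mo i).2 x))) →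
    (∀ i, ContMDiffOn 𝓘(ℝ, E4) (𝓡 4) ∞ (Φ i)
        {x | -1 < (B i).time x.1 ∧ (B i).time x.1 < 1 ∧ (B i).radius x.1 < 3 * M i + 1} ∧
      IsOpenEmbedding ({x | -1 < (B i).time x.1 ∧ (B i).time x.1 < 1 ∧
        (B i).radius x.1 < 3 * M i + 1}.restrict (Φ i))) →
    (∀ i, 𝒱.toSpacetime.truncDeviationCk (B i) (Φ i) k' (3 * M i) 0 ≤ 0) →
    collarCore M p B Φ ⊆ range 𝒱.embed →
    (∀ i, ∀ x ∈ (B i).truncTimeSlab (3 * M i) 0, 𝒱.timeOrientation.IsFutureDirected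
      (mfderiv 𝓘(ℝ, E4) (𝓡 4) (Φ i) x
        (((mo i).1 : E4 ≃L[ℝ] E4) (Kerr.timeVector (M i) (a i) (poincareInv (mo i).1 (mo i).2 x.1))))) →
    ∃ Ψ : (B 0).domain → 𝒱.carrier,
      (∀ x ∈ (B 0).truncTimeSlab (3 * M 0) 0, Ψ x = Φ 0 x) ∧
      ContinuousOn Ψ (slabDiamondWithSlab' (B 0) (M 0)) ∧
      ContMDiffOn 𝓘(ℝ, E4) (𝓡 4) ∞ Ψ (slabDiamond' (B 0) (M 0)) ∧
      IsOpenEmbedding ((slabDiamond' (B 0) (M 0)).restrict Ψ) ∧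
      Ψ '' slabDiamond' (B 0) (M 0) ⊆ interior (killingDomain 𝒱 M p B Φ) ∧
      supCkENorm (Subtype.val '' slabDiamond' (B 0) (M 0)) 0 (𝒱.toSpacetime.deviationExtend (B 0) Ψ) ≤ 0

/-- **Registered bookkeeping sub-goal of the line** (`stub_isOpenLensK`): the Kerr-side lens
`lensK M a` of the open thick slab is open (anchor under which this vocabulary file — Kerr-side sets
of the corrected F1, the corrected regions `slabDiamond'`/`slabDiamondWithSlab'`, the route statements
(A) `SlabSubdatum`, (C) `KerrSlabLensCauchy`, (D) `SubdataDevelopmentsEmbedLit`,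
(E) `SubdevelopmentFuturePlacement`, and the corrected F1' `SlabCauchyRigidity'` — serves the crux item). -/
theorem stub_isOpenLensK : ∀ (M a : ℝ), IsOpen (lensK M a) :=
  isOpen_lensK

end F1Route

end Summit.FinalStateConjecture.FinalStateConjecture.Theorems.BondiBartnikRigidity.DirectMethod

end
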